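import Mathlib
import Summits.KontsevichZagierPeriods.KontsevichZagierPeriods.Theses.SymplecticScissors
import Literature.NumberTheory.Transcendental.KZCalculusProofs
import Literature.NumberTheory.Transcendental.SemialgebraicMapsProofs
import Literature.NumberTheory.Transcendental.KZSemiCanonicalReductionProofs
import Literature.NumberTheory.Transcendental.SemialgebraicAlgebraicPoints

/-!
# `VolumeForm` (stmt-KontsevichZagierPeriods-3814), line `Sketch`

Stub `stub_primitiveSubgraphToPoint`: PLANAR SUBGRAPHS WITH A SEMIALGEBRAIC PRIMITIVE COLLAPSE TO
A POINT. For rationals `a < b`, a function `f ≥ 0` which is `ℚ`-semialgebraic on `(a, b)` and has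
a `ℚ`-semialgebraic primitive `F` on `[a, b]` (continuous on `[a, b]`, `F' = f` on `(a, b)`),
every integrand-`1` representation `s` on the open planar subgraph `{a < t < b, 0 < σ < f t}` is
KZ-equivalent to the POINT representation `c = [ℝ⁰, F b − F a]` (domain `univ`, volume `1`,
constant integrand; the constant is algebraic, being a difference of values of a
`ℚ`-semialgebraic function at rational points).

Moves. With `R = [[a, b], 𝟙_{(a,b)} f]` on `ℝ¹` (the extension by `0` keeps the integrand
`ℚ`-semialgebraic on the closed interval; integrability of `f` is the fundamental theorem of
calculus for non-negative derivatives) and `G = [{a ≤ t ≤ b, 0 ≤ σ ≤ 𝟙_{(a,b)} f (t)}, 1]`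
(`KZ.exists_underGraph`, one Newton–Leibniz move `[G] − [R]` with primitive `σ`):
`[s] − [G]` is a null modification (rule (1): the two domains differ by the segment `{σ = 0}`
and the graph of `f`), and `[R] − [c]` is ONE Newton–Leibniz move with base `ℝ⁰`, band `[a, b]`
and primitive `F` (printed rule (3) verbatim: `∫_a^b F' = F b − F a`).

Sources: M. Kontsevich, D. Zagier, *Periods* (2001), §1.2, rules (1), (3); Bochnak–Coste–Roy
1998, §2.2 (Tarski–Seidenberg); the rest is folklore calculus.
-/

noncomputable section

open Set MeasureTheory MvPolynomial
open Literature.NumberTheory.Transcendental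
open Literature.ModelTheory.ExponentialFields (IsSemialgebraic isSemialgebraic_univ)

namespace Summit.KontsevichZagierPeriods.SymplecticScissors.VolumeForm

/-- FTC integrability of a non-negative derivative, transported to `ℝ¹`: if `F` is continuous on
`[a, b]` with derivative `f ≥ 0` on `(a, b)`, then `z ↦ f (z 0)` is integrable on
`{z | z 0 ∈ (a, b)} ⊆ ℝ¹` (`intervalIntegral.integrableOn_deriv_of_nonneg` along the
volume-preserving `MeasurableEquiv.funUnique`). [folklore] -/
theorem primPt_integrableOn {a b : ℝ} {f F : ℝ → ℝ} (hFc : ContinuousOn F (Icc a b))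
    (hFd : ∀ t ∈ Ioo a b, HasDerivAt F (f t) t) (hf0 : ∀ t ∈ Ioo a b, 0 ≤ f t) :
    IntegrableOn (fun z : Fin 1 → ℝ => f (z 0)) {z : Fin 1 → ℝ | z 0 ∈ Ioo a b} :=
  ((volume_preserving_funUnique (Fin 1) ℝ).integrableOn_comp_preimage
    (MeasurableEquiv.funUnique (Fin 1) ℝ).measurableEmbedding).2
    ((intervalIntegral.integrableOn_deriv_of_nonneg hFc hFd hf0).mono_set Ioo_subset_Ioc_self)

/-- The closed-interval representation `R = [[a, b], 𝟙_{(a,b)} f]` on `ℝ¹` exists: the extension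
by `0` of `f` is `ℚ`-semialgebraic on `[a, b]` (its graph is the graph of `f` over `(a, b)` plus
two rational points) and integrable (FTC for the non-negative derivative `f = F'`). [folklore] -/
theorem primPt_exists_closedRep {a b : ℚ} {f F : ℝ → ℝ}
    (hf : IsSemialgebraicFunOn ℚ {z : Fin 1 → ℝ | z 0 ∈ Ioo (a : ℝ) b} (fun z => f (z 0)))
    (hF : IsSemialgebraicFunOn ℚ {z : Fin 1 → ℝ | z 0 ∈ Icc (a : ℝ) b} (fun z => F (z 0)))
    (hFc : ContinuousOn F (Icc (a : ℝ) b)) (hFd : ∀ t ∈ Ioo (a : ℝ) b, HasDerivAt F (f t) t)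
    (hf0 : ∀ t ∈ Ioo (a : ℝ) b, 0 ≤ f t) :
    ∃ R : KZ.IntegralRep 1, R.domain = {z : Fin 1 → ℝ | z 0 ∈ Icc (a : ℝ) b} ∧
      R.integrand = {z : Fin 1 → ℝ | z 0 ∈ Ioo (a : ℝ) b}.indicator (fun z => f (z 0)) := by
  have hIs : IsSemialgebraic ℚ {z : Fin 1 → ℝ | z 0 ∈ Ioo (a : ℝ) b} :=
    IsSemialgebraicFunOn.isSemialgebraic_holds hf
  have hJs : IsSemialgebraic ℚ {z : Fin 1 → ℝ | z 0 ∈ Icc (a : ℝ) b} :=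
    IsSemialgebraicFunOn.isSemialgebraic_holds hF
  have hIJ : {z : Fin 1 → ℝ | z 0 ∈ Ioo (a : ℝ) b} ⊆ {z : Fin 1 → ℝ | z 0 ∈ Icc (a : ℝ) b} :=
    fun z hz => Ioo_subset_Icc_self hz
  refine ⟨⟨{z : Fin 1 → ℝ | z 0 ∈ Icc (a : ℝ) b},
    {z : Fin 1 → ℝ | z 0 ∈ Ioo (a : ℝ) b}.indicator (fun z => f (z 0)), hJs, ?_, ?_⟩, rfl, rfl⟩
  · have h := hf.union (isSemialgebraicFunOn_ratCast (hJs.diff hIs) 0)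
      (F := {z : Fin 1 → ℝ | z 0 ∈ Ioo (a : ℝ) b}.indicator (fun z => f (z 0)))
      (fun z hz => indicator_of_mem hz _)
      (fun z hz => (indicator_of_notMem hz.2 _).trans Rat.cast_zero.symm)
    rwa [union_sdiff_cancel hIJ] at h
  · exact ((integrable_indicator_iff
      (Literature.ModelTheory.ExponentialFields.IsSemialgebraic.measurableSet_holds hIs)).2
      (primPt_integrableOn hFc hFd hf0)).integrableOn

/-- The point representation `c = [ℝ⁰, F b − F a]` exists: `F b − F a` is algebraic over `ℚ`
(values of the `ℚ`-semialgebraic `F` at the rational points `a`, `b`), so the constant is a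
`ℚ`-semialgebraic function on the one-point space `ℝ⁰`, which has volume `1`.
[cite: KontsevichZagier2001, §1.1] -/
theorem primPt_exists_pointRep {a b : ℚ} {F : ℝ → ℝ} (hab : a ≤ b)
    (hF : IsSemialgebraicFunOn ℚ {z : Fin 1 → ℝ | z 0 ∈ Icc (a : ℝ) b} (fun z => F (z 0))) :
    ∃ c : KZ.IntegralRep 0, c.domain = univ ∧ c.integrand = fun _ => F b - F a := by
  have hab' : (a : ℝ) ≤ b := by exact_mod_cast hab
  have halg : IsAlgebraic ℚ (F b - F a) :=
    (hF.isAlgebraic_apply_one ⟨hab', le_rfl⟩ (isAlgebraic_rat ℚ b)).sub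
      (hF.isAlgebraic_apply_one ⟨le_rfl, hab'⟩ (isAlgebraic_rat ℚ a))
  exact ⟨⟨univ, fun _ => F b - F a, isSemialgebraic_univ,
    isSemialgebraicFunOn_const_of_isAlgebraic isSemialgebraic_univ halg,
    integrableOn_const (by rw [volume_pi, Measure.pi_empty_univ]; exact ENNReal.one_ne_top)⟩,
    rfl, rfl⟩

/-- **One Newton–Leibniz move from the point** (printed rule (3) with base `ℝ⁰`): for the
closed-interval representation `R = [[a, b], 𝟙_{(a,b)} f]` and the point representation
`c = [ℝ⁰, F b − F a]`, with `F` continuous and `ℚ`-semialgebraic on `[a, b]` and `F' = f` on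
`(a, b)`, `[R] − [c] ∈ newtonLeibnizRel` (band `[a, b]` over the point, primitive `F`).
[cite: KontsevichZagier2001, §1.2 rule (3)] -/
theorem primPt_newtonLeibniz {a b : ℚ} {f F : ℝ → ℝ} (hab : a < b)
    (hF : IsSemialgebraicFunOn ℚ {z : Fin 1 → ℝ | z 0 ∈ Icc (a : ℝ) b} (fun z => F (z 0)))
    (hFc : ContinuousOn F (Icc (a : ℝ) b)) (hFd : ∀ t ∈ Ioo (a : ℝ) b, HasDerivAt F (f t) t)
    (R : KZ.IntegralRep 1) (c : KZ.IntegralRep 0)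
    (hRd : R.domain = {z : Fin 1 → ℝ | z 0 ∈ Icc (a : ℝ) b})
    (hRi : R.integrand = {z : Fin 1 → ℝ | z 0 ∈ Ioo (a : ℝ) b}.indicator (fun z => f (z 0)))
    (hcd : c.domain = univ) (hci : c.integrand = fun _ => F b - F a) :
    KZ.of R - KZ.of c ∈ KZ.newtonLeibnizRel := by
  have hab' : (a : ℝ) ≤ b := by exact_mod_cast hab.le
  refine ⟨0, R, c, fun _ => (a : ℝ), fun _ => (b : ℝ), fun z => F (z (Fin.last 0)),
    by rw [hRd]; exact hF,
    by rw [hcd]; exact isSemialgebraicFunOn_ratCast isSemialgebraic_univ a,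
    by rw [hcd]; exact isSemialgebraicFunOn_ratCast isSemialgebraic_univ b,
    fun _ _ => hab', ?_, fun x _ => ?_, fun x _ t ht => ?_, fun x _ => ?_, rfl⟩
  · rw [hRd, hcd]
    ext z
    simp only [mem_univ, true_and, mem_setOf_eq, mem_Icc]
    rfl
  · simp only [Fin.snoc_last]
    exact hFc
  · have hmem : (Fin.snoc x t : Fin 1 → ℝ) ∈ {z : Fin 1 → ℝ | z 0 ∈ Ioo (a : ℝ) b} := by
      show (Fin.snoc x t : Fin 1 → ℝ) (Fin.last 0) ∈ Ioo (a : ℝ) b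
      rwa [Fin.snoc_last]
    simp only [Fin.snoc_last, hRi, indicator_of_mem hmem]
    rw [show (0 : Fin 1) = Fin.last 0 from rfl, Fin.snoc_last]
    exact hFd t ht
  · simp only [hci, Fin.snoc_last]

/-- **The open subgraph and the closed region under the graph differ by a null set** (rule (1)):
for `R = [[a, b], 𝟙_{(a,b)} f]` and `G = [{(t, σ) | t ∈ [a, b], 0 ≤ σ ≤ 𝟙_{(a,b)} f (t)}, 1]`,
an integrand-`1` representation `s` on `{a < t < b, 0 < σ < f t}` satisfies
`[s] − [G] ∈ relations`: `s ⊆ G`, and `G ∖ s` lies in the null segment `{σ = 0}` union the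
null graph of the `ℚ`-semialgebraic integrand of `R`. [cite: KontsevichZagier2001, §1.2 rule (1)] -/
theorem primPt_null {a b : ℚ} {f : ℝ → ℝ} (s G : KZ.IntegralRep 2) (R : KZ.IntegralRep 1)
    (hsd : s.domain = {q | q 0 ∈ Ioo (a : ℝ) b ∧ 0 < q 1 ∧ q 1 < f (q 0)})
    (hsi : ∀ q ∈ s.domain, s.integrand q = 1)
    (hRd : R.domain = {z : Fin 1 → ℝ | z 0 ∈ Icc (a : ℝ) b})
    (hRi : R.integrand = {z : Fin 1 → ℝ | z 0 ∈ Ioo (a : ℝ) b}.indicator (fun z => f (z 0)))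
    (hGd : G.domain = KZlog.band R.domain (fun _ => 0) R.integrand)
    (hGi : G.integrand = fun _ => 1) :
    KZ.of s - KZ.of G ∈ KZ.relations := by
  have e0 : ∀ q : Fin 2 → ℝ, Fin.init q 0 = q 0 := fun q => rfl
  have e1 : ∀ q : Fin 2 → ℝ, q (Fin.last 1) = q 1 := fun q => rfl
  refine KZ.of_sub_of_mem_relations_of_null s G ?_ ?_ fun q hq => by rw [hsi q hq.1, hGi]
  · rw [sdiff_eq_empty.2 fun q hq => ?_, measure_empty]
    rw [hsd] at hq
    obtain ⟨hq0, hq1, hq2⟩ := hq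
    have hI : (Fin.init q : Fin 1 → ℝ) ∈ {z : Fin 1 → ℝ | z 0 ∈ Ioo (a : ℝ) b} := hq0
    rw [hGd, KZlog.mem_band, hRd, hRi, indicator_of_mem hI]
    exact ⟨Ioo_subset_Icc_self hq0, hq1.le, hq2.le⟩
  · refine measure_mono_null (fun q hq => ?_) (measure_union_null
      (KZ.volume_setOf_last_eq_zero (n := 1) 0)
      (KZ.volume_graph_eq_zero R.isSemialgebraicFunOn_integrand))
    rw [hGd, hsd] at hq
    obtain ⟨⟨hJ, h0, hle⟩, hns⟩ := hq
    simp only [mem_union, mem_setOf_eq]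
    by_cases hq1 : q (Fin.last 1) = 0
    · exact Or.inl hq1
    refine Or.inr ⟨hJ, le_antisymm hle ?_⟩
    have hpos : 0 < q (Fin.last 1) := lt_of_le_of_ne h0 (Ne.symm hq1)
    by_cases hI : (Fin.init q : Fin 1 → ℝ) ∈ {z : Fin 1 → ℝ | z 0 ∈ Ioo (a : ℝ) b}
    · rw [hRi, indicator_of_mem hI]
      show f (Fin.init q 0) ≤ q (Fin.last 1)
      rw [mem_setOf_eq, e0 q] at hI
      rw [e1 q] at hpos
      rw [e0 q, e1 q]
      exact not_lt.1 fun hlt => hns ⟨hI, hpos, hlt⟩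
    · rw [hRi, indicator_of_notMem hI] at hle
      exact absurd (hpos.trans_le hle) (lt_irrefl 0)

/-- **Planar subgraphs with a semialgebraic primitive collapse to a point.** For rationals
`a < b`, `f ≥ 0` `ℚ`-semialgebraic on `(a, b)` with a `ℚ`-semialgebraic primitive `F` on `[a, b]`
(continuous on `[a, b]`, `F' = f` on `(a, b)`), every integrand-`1` representation `s` on the
open subgraph `{a < t < b, 0 < σ < f t}` is KZ-equivalent to the point representation
`[ℝ⁰, F b − F a]`: `[s] − [c] = ([s] − [G]) + ([G] − [R]) + ([R] − [c])`, a null modification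
(rule (1)), the region-under-the-graph move (rule (3), primitive `σ`) and one Newton–Leibniz move
from the point (rule (3), primitive `F`). [cite: KontsevichZagier2001, §1.2 rules (1), (3)] -/
theorem stub_primitiveSubgraphToPoint : ∀ (a b : ℚ) (f F : ℝ → ℝ) (s : KZ.IntegralRep 2),
    a < b →
    IsSemialgebraicFunOn ℚ {z : Fin 1 → ℝ | z 0 ∈ Set.Ioo (a : ℝ) b} (fun z => f (z 0)) →
    IsSemialgebraicFunOn ℚ {z : Fin 1 → ℝ | z 0 ∈ Set.Icc (a : ℝ) b} (fun z => F (z 0)) →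
    ContinuousOn F (Set.Icc (a : ℝ) b) →
    (∀ t ∈ Set.Ioo (a : ℝ) b, HasDerivAt F (f t) t) →
    (∀ t ∈ Set.Ioo (a : ℝ) b, 0 ≤ f t) →
    s.domain = {q | q 0 ∈ Set.Ioo (a : ℝ) b ∧ 0 < q 1 ∧ q 1 < f (q 0)} →
    (∀ q ∈ s.domain, s.integrand q = 1) →
    ∃ c : KZ.IntegralRep 0, c.domain = Set.univ ∧ (∀ x, c.integrand x = F b - F a) ∧ KZ.Equivalent s c := by
  intro a b f F s hab hf hF hFc hFd hf0 hsd hsi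
  obtain ⟨R, hRd, hRi⟩ := primPt_exists_closedRep hf hF hFc hFd hf0
  obtain ⟨c, hcd, hci⟩ := primPt_exists_pointRep hab.le hF
  have h0 : ∀ z ∈ R.domain, 0 ≤ R.integrand z := fun z _ => by
    rw [hRi]
    exact indicator_nonneg (fun w hw => hf0 (w 0) hw) z
  obtain ⟨G, hGd, hGi, hGR⟩ := KZ.exists_underGraph R h0
  have hsG : KZ.of s - KZ.of G ∈ KZ.relations := primPt_null s G R hsd hsi hRd hRi hGd hGi
  have hRc : KZ.of R - KZ.of c ∈ KZ.newtonLeibnizRel :=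
    primPt_newtonLeibniz hab hF hFc hFd R c hRd hRi hcd hci
  refine ⟨c, hcd, fun x => by rw [hci], ?_⟩
  show KZ.of s - KZ.of c ∈ KZ.relations
  have : KZ.of s - KZ.of c =
      (KZ.of s - KZ.of G) + (KZ.of G - KZ.of R) + (KZ.of R - KZ.of c) := by abel
  rw [this]
  exact KZ.relations.add_mem
    (KZ.relations.add_mem hsG (KZ.newtonLeibnizRel_subset_relations hGR))
    (KZ.newtonLeibnizRel_subset_relations hRc)

end Summit.KontsevichZagierPeriods.SymplecticScissors.VolumeForm

end
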